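import Literature.Computability.MetaComplexity.ResolutionWidth
import Literature.Computability.MetaComplexity.ResolutionProofs
import Literature.Computability.MetaComplexity.XorificationLift
import HarnessLib

/-!
# Resolution: width-bounded derivability is realized by derivations of that width

Companion of `ResolutionWidth.lean` (Ben-Sasson–Wigderson's `F ⊢_w E`, the inductive
`ResDerivable F w E`: axiom download and resolution, both with weakening, all clauses of
cardinality `≤ w`) and of `Resolution.lean` / `ResolutionProofs.lean` (the tree's list derivations
`IsResDerivation φ π`, premises named by POSITION, width `resWidth π`).  `ResolutionWidth.lean` turns
list refutations into `⊢_w`-derivations (`resDerivable_restrict_of_isResRefutation`); this file is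
the converse bookkeeping: **`clauseSet φ ⊢_w E` yields a genuine resolution derivation from `φ` all
of whose lines have at most `w` literals and one of whose lines is `E`**
(`ResDerivable.exists_isResDerivation`), in particular `clauseSet φ ⊢_w ∅` yields a refutation `π`
with `resWidth π ≤ w` (`ResDerivable.exists_isResRefutation`).  The proof extends an arbitrary
derivation (`ResDerivable.exists_append`): an axiom step appends an `initial` and a `weaken` line, a
resolution step realizes both premises, then appends one `resolve` line (premise order according to
the sign of the pivot literal) and one `weaken` line; positions of earlier lines are stable under
appending.  [Ben-Sasson–Wigderson 2001, §2.1–2.3 (`F ⊢_w E`); Krajíček 2019, §5.1, §5.4]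

Mathlib search: nothing on propositional proof systems (see `Resolution.lean`).  Design: def-free;
the width bound is carried as `∀ l ∈ π, l.clause.card ≤ w` and converted with `resWidth_le_iff`.
-/

namespace Literature.Computability.MetaComplexity

open Complexity

variable {ν : Type*} [DecidableEq ν]

/-- **Realizing `⊢_w` inside a derivation.**  If `clauseSet φ ⊢_w E` then every resolution
derivation from `φ` whose lines have `≤ w` literals extends (by appending lines) to one with the same
property containing a line `E`. [Ben-Sasson–Wigderson 2001, §2.3; Krajíček 2019, §5.1] [folklore] -/
theorem ResDerivable.exists_append {φ : CNF ν} {w : ℕ} {E : Finset (Literal ν)}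
    (h : ResDerivable (clauseSet φ) w E) (π : List (ResLine ν)) (hπ : IsResDerivation φ π)
    (hπw : ∀ l ∈ π, l.clause.card ≤ w) :
    ∃ τ : List (ResLine ν), IsResDerivation φ (π ++ τ) ∧ (∀ l ∈ π ++ τ, l.clause.card ≤ w) ∧
      ∃ i, ∃ hi : i < (π ++ τ).length, ((π ++ τ)[i]'hi).clause = E := by
  induction h generalizing π with
  | @ax A E hA hAE hE =>
    have hAφ : A ∈ φ.clauseFinsets := by simpa [clauseSet] using hA
    obtain ⟨la, hla⟩ : ∃ la : ResLine ν, la = ⟨A, .initial⟩ := ⟨_, rfl⟩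
    obtain ⟨le, hle⟩ : ∃ le : ResLine ν, le = ⟨E, .weaken π.length⟩ := ⟨_, rfl⟩
    have hval₁ : IsValidResLine φ π la := by
      rw [hla]
      exact hAφ
    have hπ₁ : IsResDerivation φ (π ++ [la]) := hπ.append_singleton hval₁
    have hval₂ : IsValidResLine φ (π ++ [la]) le := by
      rw [hle]
      change ∃ hi : π.length < (π ++ [la]).length, ((π ++ [la])[π.length]'hi).clause ⊆ E
      refine ⟨by simp, ?_⟩
      rw [List.getElem_append_right le_rfl]
      simp [hla, hAE]
    have hπ₂ : IsResDerivation φ (π ++ [la] ++ [le]) := hπ₁.append_singleton hval₂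
    refine ⟨[la] ++ [le], by simpa only [List.append_assoc] using hπ₂, ?_, (π ++ [la]).length, ?_, ?_⟩
    · intro l hl
      simp only [List.mem_append, List.mem_singleton] at hl
      rcases hl with hl | rfl | rfl
      · exact hπw l hl
      · rw [hla]; exact (Finset.card_le_card hAE).trans hE
      · rw [hle]; exact hE
    · simp
    · simp only [← List.append_assoc]
      rw [List.getElem_append_right le_rfl]
      simp [hle]
  | @res C D E v b hC hD hvC hvD hsub hE ihC ihD =>
    obtain ⟨τ₁, hπ₁, hw₁, i, hi, hiC⟩ := ihC π hπ hπw
    obtain ⟨τ₂, hπ₂, hw₂, j, hj, hjD⟩ := ihD (π ++ τ₁) hπ₁ hw₁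
    -- position `i` is stable
    obtain ⟨hi₂, hiC₂⟩ :
        ∃ hi' : i < (π ++ τ₁ ++ τ₂).length, ((π ++ τ₁ ++ τ₂)[i]'hi').clause = C :=
      ⟨by rw [List.length_append]; omega, by rw [List.getElem_append_left hi]; exact hiC⟩
    set P := π ++ τ₁ ++ τ₂ with hP
    -- the resolvent line, premise order according to the sign `b` of the pivot literal in `C`
    obtain ⟨lr, hlr⟩ : ∃ lr : ResLine ν, lr =
        ⟨if b then C.erase (v, true) ∪ D.erase (v, false) else D.erase (v, true) ∪ C.erase (v, false),
          if b then .resolve i j v else .resolve j i v⟩ := ⟨_, rfl⟩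
    have hlr_sub : lr.clause ⊆ E := by
      rw [hlr]
      cases b
      · simp only [Bool.false_eq_true, if_false]
        rw [Finset.union_comm]
        exact hsub
      · simpa using hsub
    have hval : IsValidResLine φ P lr := by
      rw [hlr]
      cases b
      · change ∃ hj' : j < P.length, ∃ hi' : i < P.length,
          IsResolvent (P[j]'hj').clause (P[i]'hi').clause v (D.erase (v, true) ∪ C.erase (v, false))
        refine ⟨hj, hi₂, ?_⟩
        rw [hjD, hiC₂]
        exact ⟨by simpa using hvD, hvC, rfl⟩
      · change ∃ hi' : i < P.length, ∃ hj' : j < P.length,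
          IsResolvent (P[i]'hi').clause (P[j]'hj').clause v (C.erase (v, true) ∪ D.erase (v, false))
        refine ⟨hi₂, hj, ?_⟩
        rw [hjD, hiC₂]
        exact ⟨hvC, by simpa using hvD, rfl⟩
    have hπ₃ : IsResDerivation φ (P ++ [lr]) := hπ₂.append_singleton hval
    obtain ⟨lw, hlw⟩ : ∃ lw : ResLine ν, lw = ⟨E, .weaken P.length⟩ := ⟨_, rfl⟩
    have hval' : IsValidResLine φ (P ++ [lr]) lw := by
      rw [hlw]
      change ∃ hk : P.length < (P ++ [lr]).length, ((P ++ [lr])[P.length]'hk).clause ⊆ E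
      refine ⟨by simp, ?_⟩
      rw [List.getElem_append_right le_rfl]
      simpa using hlr_sub
    have hπ₄ : IsResDerivation φ (P ++ [lr] ++ [lw]) := hπ₃.append_singleton hval'
    refine ⟨τ₁ ++ τ₂ ++ [lr] ++ [lw], by simpa only [hP, List.append_assoc] using hπ₄, ?_,
      (P ++ [lr]).length, ?_, ?_⟩
    · intro l hl
      have hl' : l ∈ P ∨ l = lr ∨ l = lw := by
        simpa only [hP, List.append_assoc, List.mem_append, List.mem_singleton, or_assoc] using hl
      rcases hl' with hl | rfl | rfl
      · exact hw₂ l hl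
      · exact (Finset.card_le_card hlr_sub).trans hE
      · rw [hlw]; exact hE
    · simp [hP]
    · have e : π ++ (τ₁ ++ τ₂ ++ [lr] ++ [lw]) = P ++ [lr] ++ [lw] := by
        simp only [hP, List.append_assoc]
      simp only [e]
      rw [List.getElem_append_right le_rfl]
      simp [hlw]

/-- **`⊢_w`-derivable clauses occur in width-`w` derivations**: if `clauseSet φ ⊢_w E` then some
resolution derivation from `φ` of width `≤ w` contains the line `E`.
[Ben-Sasson–Wigderson 2001, §2.3 (`w(F ⊢ E)`); Krajíček 2019, §5.4] [folklore] -/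
theorem ResDerivable.exists_isResDerivation {φ : CNF ν} {w : ℕ} {E : Finset (Literal ν)}
    (h : ResDerivable (clauseSet φ) w E) :
    ∃ π : List (ResLine ν), IsResDerivation φ π ∧ resWidth π ≤ w ∧ ∃ l ∈ π, l.clause = E := by
  obtain ⟨τ, hτ, hw, i, hi, hiE⟩ := h.exists_append [] (isResDerivation_nil φ) (by simp)
  simp only [List.nil_append] at hτ hw hi hiE
  exact ⟨τ, hτ, resWidth_le_iff.2 hw, τ[i], List.getElem_mem hi, hiE⟩

/-- **`clauseSet φ ⊢_w ∅` gives a refutation of width `≤ w`** in the tree's list format.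
[Ben-Sasson–Wigderson 2001, §2.3 (`w(F ⊢ 0)`); Krajíček 2019, §5.4] [folklore] -/
theorem ResDerivable.exists_isResRefutation {φ : CNF ν} {w : ℕ}
    (h : ResDerivable (clauseSet φ) w ∅) :
    ∃ π : List (ResLine ν), IsResRefutation φ π ∧ resWidth π ≤ w := by
  obtain ⟨π, hπ, hw, l, hl, hlE⟩ := h.exists_isResDerivation
  exact ⟨π, ⟨hπ, l, hl, hlE⟩, hw⟩

end Literature.Computability.MetaComplexity
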